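import Summits.ResolutionOfSingularities.ResolutionOfSingularities.Theorems.WildDescent7
import HarnessLib

/-!
# WildDescent (8/13) — β-descent in a linear frame; §7 NextStage (L4 `reprep_k`/`reprep_E`, L6 `posE_*`, `next_frame_eq`)

Verbatim slice of the farm-checked monolith `WildDescent.lean` of cell `decomp-res`, seat `decomp-res-lens-5`, g36
(sha256 4ec0fa6f4f9efba7…); one namespace `Summit.ResolutionOfSingularities.ResolutionOfSingularities.Theorems.WildDescent` across the
slices, imports chained (laws L1–L7 and the mechanism: module docstring of slice 1; main theorems: slice 13/13).
-/

open MvPolynomial Finset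
open scoped BigOperators
open Literature.AlgebraicGeometry.Resolution
open Literature.AlgebraicGeometry.Resolution.Hauser2010
open Literature.AlgebraicGeometry.Resolution.PointBlowup
open Literature.AlgebraicGeometry.Resolution.HauserPerlega2024

namespace Summit.ResolutionOfSingularities.ResolutionOfSingularities.Theorems.WildDescent

/-! ## §7 THE NEXT STAGE (L4 re-preparation test, L6 entry law): letters `z` (new free), `k` (kept wall), `E` (new wall =
the exceptional letter `j`); slots `(u, v)` with `{u, v} = {k, E}`, `E` having inherited the slot of the lost wall. -/

section NextStage

variable {K : Type} [Field K]

/-- `zshear z 0 = id`. [folklore] -/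
theorem zshear_zero_apply {σ : Type*} [DecidableEq σ] (z : σ) (P : MvPolynomial σ K) : WallFrames.zshear z 0 P = P := by
  have h := WallFrames.zshear_neg_zshear (z := z) (ζ := (0 : MvPolynomial σ K)) (fun μ hμ => by simp at hμ) P
  rw [neg_zero, WallFrames.zshear_zshear (fun μ hμ => by simp at hμ), add_zero] at h
  exact h

/-- DOMINATION ⇒ every near monomial of the new frame polynomial involves the new wall. [new] -/
theorem posE_of_dom {z k E u v : Fin 3} (hslot : (u = k ∧ v = E) ∨ (u = E ∧ v = k)) {s : ℕ}
    {P : MvPolynomial (Fin 3) K} {Y : Finset (ℚ × ℚ)} (hdom : ∀ x ∈ pts s z u v P, ∃ y ∈ Y, y.1 ≤ x.1 ∧ y.2 ≤ x.2)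
    (hY : ∀ y ∈ Y, (v = E → 0 < y.2) ∧ (u = E → 0 < y.1)) : ∀ D ∈ P.support, D z < s → D E ≠ 0 := by
  intro D hD hDz hDE
  obtain ⟨y, hy, hy1, hy2⟩ := hdom _ (pt_mem_pts hD hDz)
  rcases hslot with ⟨rfl, rfl⟩ | ⟨rfl, rfl⟩
  · have h0 : (pt s z u v D).2 = 0 := by simp [pt, hDE]
    linarith [(hY y hy).1 rfl]
  · have h0 : (pt s z u v D).1 = 0 := by simp [pt, hDE]
    linarith [(hY y hy).2 rfl]

/-- … and conversely such a frame polynomial has all its points off the `k`-axis (slot-`E` coordinate `> 0`). [new] -/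
theorem pos_of_posE {z k E u v : Fin 3} (hkE : k ≠ E) (hslot : (u = k ∧ v = E) ∨ (u = E ∧ v = k)) {s : ℕ}
    {P : MvPolynomial (Fin 3) K} (hpos : ∀ D ∈ P.support, D z < s → D E ≠ 0) :
    ∀ x ∈ pts s z u v P, (v = E → 0 < x.2) ∧ (u = E → 0 < x.1) := by
  intro x hx
  obtain ⟨D, hD, hDz, rfl⟩ := mem_pts.mp hx
  have hE : 0 < D E := Nat.pos_of_ne_zero (hpos D hD hDz)
  have hden : (0 : ℚ) < ((s - D z : ℕ) : ℚ) := by exact_mod_cast Nat.sub_pos_of_lt hDz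
  have hq : (0 : ℚ) < ((D E : ℕ) : ℚ) / ((s - D z : ℕ) : ℚ) := div_pos (by exact_mod_cast hE) hden
  rcases hslot with ⟨rfl, rfl⟩ | ⟨rfl, rfl⟩
  · exact ⟨fun _ => hq, fun h => absurd h hkE⟩
  · exact ⟨fun h => absurd h.symm hkE.symm, fun _ => hq⟩

/-- The `E`-shear does not create near monomials prime to `y_E` (L6, algebraic half). [new] -/
theorem posE_zshear {z E : Fin 3} {s : ℕ} {P : MvPolynomial (Fin 3) K} (hpos : ∀ D ∈ P.support, D z < s → D E ≠ 0)
    (ν : K) : ∀ D ∈ (WallFrames.zshear z (C ν * X E) P).support, D z < s → D E ≠ 0 := by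
  intro D hD hDz hDE
  have hζ : (C ν * X E : MvPolynomial (Fin 3) K) ∈ Ideal.span {(X E : MvPolynomial (Fin 3) K)} :=
    Ideal.mul_mem_left _ _ (Ideal.subset_span rfl)
  have h := mem_support_iff.mp hD
  rw [coeff_zshear_of_apply_eq_zero (C ν * X E) hζ P hDE] at h
  exact hpos D (mem_support_iff.mpr h) hDz hDE

/-- Shearing a linear form: `σ_ζ^{(z)}(ℓ) = ℓ + ℓ_z · ζ`. [folklore] -/
theorem zshear_lin_eq {z k E : Fin 3} (hzk : z ≠ k) (hzE : z ≠ E) (hkE : k ≠ E) {ℓ : MvPolynomial (Fin 3) K}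
    (hℓ : ℓ.IsHomogeneous 1) (ζ : MvPolynomial (Fin 3) K) :
    WallFrames.zshear z ζ ℓ = ℓ + C (coeff (Finsupp.single z 1) ℓ) * ζ := by
  set κ := coeff (Finsupp.single z 1) ℓ with hκ
  have h3 := linear_eq_three hzk hzE hkE hℓ
  rw [← hκ] at h3
  conv_lhs => rw [h3]
  conv_rhs => rw [h3]
  rw [map_add, map_add, map_mul, map_mul, map_mul, WallFrames.zshear_C, WallFrames.zshear_C, WallFrames.zshear_C,
    WallFrames.zshear_X_self, WallFrames.zshear_X_of_ne (Ne.symm hzk), WallFrames.zshear_X_of_ne (Ne.symm hzE)]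
  ring

/-- TANGENT DATA OF THE TRANSPORTED FRAME: if `in_s(G') = c'·ℓ'^s` and `H^new = σ_{−μ y_k}^{(z)}(G')` then
`in_s(H^new) = c'·L^s` with `L = ℓ' − ℓ'_z μ y_k` (so `L_k = ℓ'_k − ℓ'_z μ`, `L_E = ℓ'_E`, `L_z = ℓ'_z`). [new] -/
theorem in_transport {z k E : Fin 3} (hzk : z ≠ k) (hzE : z ≠ E) (hkE : k ≠ E) {s : ℕ} {G' ℓ : MvPolynomial (Fin 3) K}
    {c : K} (hin : homogeneousComponent s G' = C c * ℓ ^ s) (hℓ : ℓ.IsHomogeneous 1) (μ : K) :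
    homogeneousComponent s (WallFrames.zshear z (-(C μ * X k)) G') =
      C c * (ℓ + C (coeff (Finsupp.single z 1) ℓ) * (-(C μ * X k))) ^ s := by
  have hζ : (-(C μ * X k) : MvPolynomial (Fin 3) K).IsHomogeneous 1 := ((isHomogeneous_X K k).C_mul μ).neg
  rw [homogeneousComponent_zshear hζ, hin, zshear_C_mul_pow, zshear_lin_eq hzk hzE hkE hℓ]

/-- Transporting a linear form along the shear `y_z ↦ y_z − μ y_k` keeps it homogeneous of degree 1. [folklore] -/
theorem lin_transport_isHomogeneous {k : Fin 3} {ℓ : MvPolynomial (Fin 3) K} (hℓ : ℓ.IsHomogeneous 1) (a μ : K) :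
    (ℓ + C a * (-(C μ * X k))).IsHomogeneous 1 := by
  have : (C a * (-(C μ * X k)) : MvPolynomial (Fin 3) K) = C (-(a * μ)) * X k := by rw [map_neg, map_mul]; ring
  rw [this]
  exact hℓ.add ((isHomogeneous_X K k).C_mul _)

/-- The `y_k`-coefficient of the transported linear form `ℓ − a μ y_k` is `ℓ_k − a μ`. [folklore] -/
theorem coeff_lin_transport_k {k : Fin 3} (ℓ : MvPolynomial (Fin 3) K) (a μ : K) :
    coeff (Finsupp.single k 1) (ℓ + C a * (-(C μ * X k))) = coeff (Finsupp.single k 1) ℓ - a * μ := by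
  rw [coeff_add, mul_neg, coeff_neg, ← mul_assoc, ← map_mul, coeff_C_mul, coeff_X, if_pos rfl]; ring

/-- The transported linear form `ℓ − a μ y_k` has the same `y_i`-coefficient as `ℓ` for `i ≠ k`. [folklore] -/
theorem coeff_lin_transport_of_ne {k i : Fin 3} (hik : i ≠ k) (ℓ : MvPolynomial (Fin 3) K) (a μ : K) :
    coeff (Finsupp.single i 1) (ℓ + C a * (-(C μ * X k))) = coeff (Finsupp.single i 1) ℓ := by
  rw [coeff_add, mul_neg, coeff_neg, ← mul_assoc, ← map_mul, coeff_C_mul, coeff_X,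
    if_neg (fun h => hik (Finsupp.single_left_injective one_ne_zero h).symm)]
  ring

/-- A pure power `y_i^s` present in `in_s` is a monomial of the polynomial. [folklore] -/
theorem single_mem_support_of_coeff {s : ℕ} {P L : MvPolynomial (Fin 3) K} {c : K} (hin : homogeneousComponent s P = C c * L ^ s)
    (hL : L.IsHomogeneous 1) (hc : c ≠ 0) {i : Fin 3} (hi : coeff (Finsupp.single i 1) L ≠ 0) :
    Finsupp.single i s ∈ P.support := by
  rw [mem_support_iff]
  have h : coeff (Finsupp.single i s) (homogeneousComponent s P) = coeff (Finsupp.single i s) P := by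
    rw [coeff_homogeneousComponent, if_pos (Finsupp.degree_single i s)]
  rw [← h, hin, coeff_single_C_mul_pow hL]
  exact mul_ne_zero hc (pow_ne_zero _ hi)

/-- **RE-PREPARATION TEST, kept wall (L4a): the new tangent form has NO `y_k`-component beyond the transported one**
(`L_k = 0`): otherwise `y_k^s` would be a near monomial of the new frame polynomial prime to the new wall. [new] -/
theorem reprep_k {z k E : Fin 3} (hzk : z ≠ k) (hkE : k ≠ E) {s : ℕ} (hs : s ≠ 0) {P L : MvPolynomial (Fin 3) K} {c : K}
    (hpos : ∀ D ∈ P.support, D z < s → D E ≠ 0) (hin : homogeneousComponent s P = C c * L ^ s) (hL : L.IsHomogeneous 1)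
    (hc : c ≠ 0) : coeff (Finsupp.single k 1) L = 0 := by
  by_contra hk
  have hmem := single_mem_support_of_coeff hin hL hc hk
  refine hpos _ hmem ?_ ?_
  · rw [Finsupp.single_apply, if_neg (Ne.symm hzk)]; exact Nat.pos_of_ne_zero hs
  · rw [Finsupp.single_apply, if_neg hkE]

/-- **RE-PREPARATION TEST, new wall (L4b): a `y_E`-component of the new tangent form forces a dominating point ON the
`E`-axis**, i.e. an old point with slot-`k` coordinate `0` (`α = 0` after a `Φ`-move, `ε = 0` after a `Ψ`-move). [new] -/
theorem reprep_E {z k E u v : Fin 3} (hzE : z ≠ E) (hkE : k ≠ E) {s : ℕ}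
    (hs : s ≠ 0) {P L : MvPolynomial (Fin 3) K} {c : K} {Y : Finset (ℚ × ℚ)}
    (hdom : ∀ x ∈ pts s z u v P, ∃ y ∈ Y, y.1 ≤ x.1 ∧ y.2 ≤ x.2) (hin : homogeneousComponent s P = C c * L ^ s)
    (hL : L.IsHomogeneous 1) (hc : c ≠ 0) (hE : coeff (Finsupp.single E 1) L ≠ 0) :
    ∃ y ∈ Y, (u = k → y.1 ≤ 0) ∧ (v = k → y.2 ≤ 0) := by
  have hmem := single_mem_support_of_coeff hin hL hc hE
  have hz : (Finsupp.single E s : Fin 3 →₀ ℕ) z < s := by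
    rw [Finsupp.single_apply, if_neg (Ne.symm hzE)]; exact Nat.pos_of_ne_zero hs
  obtain ⟨y, hy, hy1, hy2⟩ := hdom _ (pt_mem_pts hmem hz)
  refine ⟨y, hy, fun hu => ?_, fun hv => ?_⟩
  · have : (pt s z u v (Finsupp.single E s)).1 = 0 := by simp [pt, Finsupp.single_apply, hu, hkE.symm]
    linarith
  · have : (pt s z u v (Finsupp.single E s)).2 = 0 := by simp [pt, Finsupp.single_apply, hv, hkE.symm]
    linarith

/-- **THE NEXT FRAME POLYNOMIAL.**  With `G' = σ_{μ y_k}^{(z)}(H^new)` and the new normalised shear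
`η' = (ℓ'_k/ℓ'_z) y_k + (ℓ'_E/ℓ'_z) y_E`: if `ℓ'_k = ℓ'_z μ` (L4a) then `σ_{−η'}(G') = σ_{−(ℓ'_E/ℓ'_z) y_E}(H^new)`, and if
moreover `ℓ'_E = 0` (L4b) it IS `H^new`. [new] -/
theorem next_frame_eq {z k E : Fin 3} (hzk : z ≠ k) {G' Hn ℓ : MvPolynomial (Fin 3) K} {μ : K}
    (hHn : Hn = WallFrames.zshear z (-(C μ * X k)) G') (hκ : coeff (Finsupp.single z 1) ℓ ≠ 0)
    (hk : coeff (Finsupp.single k 1) ℓ - coeff (Finsupp.single z 1) ℓ * μ = 0) :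
    WallFrames.zshear z (-(C (coeff (Finsupp.single k 1) ℓ / coeff (Finsupp.single z 1) ℓ) * X k +
        C (coeff (Finsupp.single E 1) ℓ / coeff (Finsupp.single z 1) ℓ) * X E)) G' =
      WallFrames.zshear z (-(C (coeff (Finsupp.single E 1) ℓ / coeff (Finsupp.single z 1) ℓ) * X E)) Hn := by
  have hμ : coeff (Finsupp.single k 1) ℓ / coeff (Finsupp.single z 1) ℓ = μ := by
    rw [div_eq_iff hκ]; linear_combination hk
  have hG' : G' = WallFrames.zshear z (C μ * X k) Hn := by
    rw [hHn, WallFrames.zshear_zshear_neg]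
    exact WallFrames.varFree_mul (WallFrames.varFree_C z μ) (WallFrames.varFree_X_of_ne (Ne.symm hzk))
  rw [hμ, hG', WallFrames.zshear_zshear (WallFrames.varFree_mul (WallFrames.varFree_C z μ) (WallFrames.varFree_X_of_ne (Ne.symm hzk)))]
  congr 1
  congr 1; ring

/-- Law L4 (conclusion): if the new tangent form has no kept-wall and no new-wall component after transport, the next frame polynomial coincides with the transported polynomial `H^new = σ(G')` — no re-preparation occurs. [new] -/
theorem next_frame_eq' {z k E : Fin 3} (hzk : z ≠ k) {G' Hn ℓ : MvPolynomial (Fin 3) K} {μ : K}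
    (hHn : Hn = WallFrames.zshear z (-(C μ * X k)) G') (hκ : coeff (Finsupp.single z 1) ℓ ≠ 0)
    (hk : coeff (Finsupp.single k 1) ℓ - coeff (Finsupp.single z 1) ℓ * μ = 0) (hE : coeff (Finsupp.single E 1) ℓ = 0) :
    WallFrames.zshear z (-(C (coeff (Finsupp.single k 1) ℓ / coeff (Finsupp.single z 1) ℓ) * X k +
        C (coeff (Finsupp.single E 1) ℓ / coeff (Finsupp.single z 1) ℓ) * X E)) G' = Hn := by
  rw [next_frame_eq (E := E) hzk hHn hκ hk, hE, zero_div, C_0, zero_mul, neg_zero, zshear_zero_apply]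

end NextStage

end Summit.ResolutionOfSingularities.ResolutionOfSingularities.Theorems.WildDescent
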